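import Mathlib
import HarnessLib
import Summits.CriticalPhenomena.CardyFormulaZ2.Theses.CardyStressTensorWard

/-!
# Birth skeleton of the split child `LocalizedVariation` (stmt-CriticalPhenomena-18761) of `HadamardRegularity`

`LocalizedVariation ⇐ stub_awayFromMarks ∧ stub_atMark` — the two boundary regimes of the local first-order
response: bumps whose `2ρ'`-neighbourhood misses the four marked points (interior-of-arc response: half-plane
3-arm density) and bumps centred at a marked point (response of the crossing limit to moving / deforming near a
mark: half-plane 2-arm density, `∂Λ/∂(mark)`). Both stubs scale in the radius `ρ' ≤ ρᵢ(R)`; the composition takes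
`ρ = min ρ₁ (ρ₂/3)`: a `ρ`-ball either has all marks at distance `≥ 2ρ` from its centre (regime 1) or lies inside the
`3ρ`-ball of a mark (regime 2). Strategist `cstrat-stmt-CriticalPhenomena-4567-r1` (parent crux stmt-4567; written
under the parent's `Cruxes/HadamardRegularity/Lines/` because only the child's own seats may write its crux dir).
-/

namespace Summit.CriticalPhenomena.CardyFormulaZ2.Cruxes.HadamardRegularity.BirthLocalizedVariation

open scoped Topology
open Filter Set Metric
open Literature.Probability.Percolation Literature.Probability.RandomPlanarGeometry

/-- Stub 1 — local first variation AWAY FROM THE MARKS: bumps in a `ρ'`-ball (`ρ' ≤ ρ₁(R)`) whose centre is at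
distance `≥ 2ρ'` from every marked point `R.pt i` have an asymptotic, mesh-uniform first variation along every
family with germ `id + εV` on `R̄` (mechanism: sharp half-plane 3-arm density on the open arcs; trivial for bumps
missing `R̄`). -/
theorem stub_awayFromMarks :
    (open Literature.Probability.Percolation Literature.Probability.LatticeModels Literature.Probability.RandomPlanarGeometry in ∀ R : ConformalRectangle, ∃ ρ₁ : ℝ, 0 < ρ₁ ∧ ∀ (ρ' : ℝ) (z₀ : ℂ) (V : ℂ → ℂ), 0 < ρ' → ρ' ≤ ρ₁ → (∀ i : Fin 4, 2 * ρ' ≤ dist (R.pt i) z₀) → ContDiff ℝ 2 V → (∃ B : ℝ, ∀ z : ℂ, ‖V z‖ ≤ B * (1 + ‖z‖) ∧ ‖fderiv ℝ V z‖ ≤ B) → tsupport V ⊆ Metric.ball z₀ ρ' → ∃ L : ℝ, ∀ Φ : ℝ → ℂ ≃ₜ ℂ, (∀ᶠ ε in 𝓝 (0:ℝ), ∀ z ∈ closure R.carrier, Φ ε z = z + (ε : ℂ) * V z) → ∀ η : ℝ, 0 < η → ∀ᶠ ε in 𝓝 (0:ℝ), ∀ᶠ δ in 𝓝[>] (0:ℝ),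 |bondDomainCrossingProb (R.map (Φ ε)) δ - bondDomainCrossingProb (R.map (Φ 0)) δ - ε * L| ≤ η * |ε|) := by
  sorry

/-- Stub 2 — local first variation AT A MARK: bumps in the `ρ'`-ball (`ρ' ≤ ρ₂(R)`) around a marked point `R.pt i`
have an asymptotic, mesh-uniform first variation (mechanism: half-plane 2-arm density at the mark; under CI it is
`F'(η)·∂η/∂xᵢ` for the tangential part plus the 3-arm density of the two adjacent arcs). -/
theorem stub_atMark :
    (open Literature.Probability.Percolation Literature.Probability.LatticeModels Literature.Probability.RandomPlanarGeometry in ∀ R : ConformalRectangle, ∃ ρ₂ : ℝ, 0 < ρ₂ ∧ ∀ (ρ' : ℝ) (i : Fin 4) (V : ℂ → ℂ), 0 < ρ' → ρ' ≤ ρ₂ → ContDiff ℝ 2 V → (∃ B : ℝ, ∀ z : ℂ, ‖V z‖ ≤ B * (1 + ‖z‖) ∧ ‖fderiv ℝ V z‖ ≤ B) → tsupport V ⊆ Metric.ball (R.pt i) ρ' → ∃ L : ℝ, ∀ Φ : ℝ → ℂ ≃ₜ ℂ, (∀ᶠ ε in 𝓝 (0:ℝ), ∀ z ∈ closure R.carrier,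 Φ ε z = z + (ε : ℂ) * V z) → ∀ η : ℝ, 0 < η → ∀ᶠ ε in 𝓝 (0:ℝ), ∀ᶠ δ in 𝓝[>] (0:ℝ), |bondDomainCrossingProb (R.map (Φ ε)) δ - bondDomainCrossingProb (R.map (Φ 0)) δ - ε * L| ≤ η * |ε|) := by
  sorry

/-- Composition lemma (sorry-free): the two regimes give the child's statement with `ρ = min ρ₁ (ρ₂ / 3)`. -/
theorem localizedVariation_of_pieces :
    (open Literature.Probability.Percolation Literature.Probability.LatticeModels Literature.Probability.RandomPlanarGeometry in ∀ R : ConformalRectangle, ∃ ρ₁ : ℝ, 0 < ρ₁ ∧ ∀ (ρ' : ℝ) (z₀ : ℂ) (V : ℂ → ℂ), 0 < ρ' → ρ' ≤ ρ₁ → (∀ i : Fin 4, 2 * ρ' ≤ dist (R.pt i) z₀) → ContDiff ℝ 2 V → (∃ B : ℝ, ∀ z : ℂ, ‖V z‖ ≤ B * (1 + ‖z‖) ∧ ‖fderiv ℝ V z‖ ≤ B) → tsupport V ⊆ Metric.ball z₀ ρ' → ∃ L : ℝ, ∀ Φ : ℝ → ℂ ≃ₜ ℂ, (∀ᶠ ε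 in 𝓝 (0:ℝ), ∀ z ∈ closure R.carrier, Φ ε z = z + (ε : ℂ) * V z) → ∀ η : ℝ, 0 < η → ∀ᶠ ε in 𝓝 (0:ℝ), ∀ᶠ δ in 𝓝[>] (0:ℝ), |bondDomainCrossingProb (R.map (Φ ε)) δ - bondDomainCrossingProb (R.map (Φ 0)) δ - ε * L| ≤ η * |ε|) →
    (open Literature.Probability.Percolation Literature.Probability.LatticeModels Literature.Probability.RandomPlanarGeometry in ∀ R : ConformalRectangle, ∃ ρ₂ : ℝ, 0 < ρ₂ ∧ ∀ (ρ' : ℝ) (i : Fin 4) (V : ℂ → ℂ), 0 < ρ' → ρ' ≤ ρ₂ → ContDiff ℝ 2 V → (∃ B : ℝ, ∀ z : ℂ, ‖V z‖ ≤ B * (1 + ‖z‖) ∧ ‖fderiv ℝ V z‖ ≤ B) → tsupport V ⊆ Metric.ball (R.pt i) ρ' → ∃ L : ℝ, ∀ Φ : ℝ → ℂ ≃ₜ ℂ, (∀ᶠ ε in 𝓝 (0:ℝ), ∀ z ∈ closure R.carrier, Φ ε z = z + (ε : ℂ) * V z) → ∀ η : ℝ, 0 < η → ∀ᶠ ε in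 𝓝 (0:ℝ), ∀ᶠ δ in 𝓝[>] (0:ℝ), |bondDomainCrossingProb (R.map (Φ ε)) δ - bondDomainCrossingProb (R.map (Φ 0)) δ - ε * L| ≤ η * |ε|) →
    (open Literature.Probability.Percolation Literature.Probability.LatticeModels Literature.Probability.RandomPlanarGeometry in ∀ R : ConformalRectangle, ∃ ρ : ℝ, 0 < ρ ∧ ∀ (z₀ : ℂ) (V : ℂ → ℂ), ContDiff ℝ 2 V → (∃ B : ℝ, ∀ z : ℂ, ‖V z‖ ≤ B * (1 + ‖z‖) ∧ ‖fderiv ℝ V z‖ ≤ B) → tsupport V ⊆ Metric.ball z₀ ρ → ∃ L : ℝ, ∀ Φ : ℝ → ℂ ≃ₜ ℂ, (∀ᶠ ε in 𝓝 (0:ℝ), ∀ z ∈ closure R.carrier, Φ ε z = z + (ε : ℂ) * V z) → ∀ η : ℝ, 0 < η → ∀ᶠ ε in 𝓝 (0:ℝ), ∀ᶠ δ in 𝓝[>] (0:ℝ), |bondDomainCrossingProb (R.map (Φ ε)) δ - bondDomainCrossingProb (R.map (Φ 0)) δ - ε * L| ≤ η * |ε|) := by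
  intro hA hM R
  obtain ⟨ρ₁, hρ₁, hA⟩ := hA R
  obtain ⟨ρ₂, hρ₂, hM⟩ := hM R
  have hρ : 0 < min ρ₁ (ρ₂ / 3) := lt_min hρ₁ (by positivity)
  refine ⟨min ρ₁ (ρ₂ / 3), hρ, fun z₀ V hV1 hV2 hsupp => ?_⟩
  by_cases h : ∀ i : Fin 4, 2 * min ρ₁ (ρ₂ / 3) ≤ dist (R.pt i) z₀
  · exact hA _ z₀ V hρ (min_le_left _ _) h hV1 hV2 hsupp
  · push_neg at h
    obtain ⟨i, hi⟩ := h
    have hsub : tsupport V ⊆ Metric.ball (R.pt i) (3 * min ρ₁ (ρ₂ / 3)) := hsupp.trans fun z hz => by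
      rw [Metric.mem_ball] at hz ⊢
      calc dist z (R.pt i) ≤ dist z z₀ + dist z₀ (R.pt i) := dist_triangle _ _ _
        _ < min ρ₁ (ρ₂ / 3) + 2 * min ρ₁ (ρ₂ / 3) := add_lt_add hz (by rwa [dist_comm])
        _ = 3 * min ρ₁ (ρ₂ / 3) := by ring
    exact hM _ i V (by positivity) (by linarith [min_le_right ρ₁ (ρ₂ / 3)]) hV1 hV2 hsub

/-- **Registered composition BY NAME** (`ledger skeleton check --crux <child item>`): the ROUTE DECL
`CardyStressTensorWard.LocalizedVariation` (rev-5 route file) from the two sorried stubs `stub_awayFromMarks`,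
`stub_atMark` through the sorry-free composition lemma `localizedVariation_of_pieces` (the decl's body is
definitionally that lemma's conclusion). No sorry here; the only sorries of the file are the two stubs. -/
theorem LocalizedVariation_of :
    Summit.CriticalPhenomena.CardyFormulaZ2.Theses.CardyStressTensorWard.LocalizedVariation :=
  localizedVariation_of_pieces stub_awayFromMarks stub_atMark

end Summit.CriticalPhenomena.CardyFormulaZ2.Cruxes.HadamardRegularity.BirthLocalizedVariation
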